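import Summits.Ventures.HodgeRepro.SexticFaces
import Summits.Ventures.HodgeRepro.ProdTransfer

/-!
# The sealed Weil plane of `B × E` (§A.3, clause (4)) is Lemma R applied to the sealed faces

Blind re-derivation cell `pub-hodge-repro`, seat `typer` (gen 3).  Continues `SexticFaces.lean` /
`ProdTransfer.lean`.

The sealed `Census` (§A.3) says in clause (3) that every face of the cyclic sextic field has three
primitive corners forming a packet `{Ψ, Ψ+2, Ψ+4}` and one `k`-induced corner, and in clause (4) that
the Pohlmann `4`-sets of `Y = B × E` which are not `c`-stable are exactly `{0,2,4} ⊔ {e₀}` and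
`{1,3,5} ⊔ {e₁}` (the Weil plane of `(B × E, k)`).  This file shows the two clauses are one fact:

* every sealed face is a *packet* — its corners are `Φ6 + m, Φ6 + m + 2, Φ6 + m + 4, ΦE + m` for some
  `m` (`faces_eq_packet`; `Φ6 = {0,1,2}` is the type of `B`, `ΦE = {1,3,5} = π⁻¹{1}` the lift of the
  type `{1}` of `E`), i.e. the corner product is `B³ × E³` with twists `m, m+2, m+4, m` (`packetTwist`);
* Lemma R (`isHodgeSetProd_reducedSet`) for the packet: the reduced set at every `s` is a Pohlmann set
  of `(Φ6, ΦE)` on `B³ × E³` — `isHodgeSetProd_packet` (the hypotheses `SumTwo` and distinct pairs are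
  decided once for all `m`);
* the type map `ρ : Bool × C6 → Pt` (`B`-embeddings `↦ inl`, `E`-embeddings `↦ inr (mod 2)`) pulls the
  sealed `phi` back to `(Φ6, ΦE)` (`isTypeMap_ρ`), so by `ProdTransfer` the images of the reduced sets
  are Pohlmann sets of `(Pt, phi)` — `isHodgeSetOn_image_reducedSet` (structural);
* **`weilPlane_eq_image_reducedSets`**: the sealed non-`c`-stable Pohlmann `4`-sets of `B × E` are
  EXACTLY the images of Lemma R's reduced sets of the base packet (`m = 0`), and
  `image_reducedSet_mem` names them: `{σ⁰,σ²,σ⁴} ⊔ {e₀}` and `{σ¹,σ³,σ⁵} ⊔ {e₁}`.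
-/

open Finset
open scoped Pointwise

namespace HodgeRepro

namespace SexticBridge

open Summit.Ventures.HodgeRepro.FaceCensus.Sextic
open Multiplicative

/-! ### The packet and its type map -/

/-- The lift `{1, 3, 5} = π⁻¹{1}` to `F` of the CM type `{1} ⊂ ℤ/2` of the elliptic curve `E` (the
`k`-induced corner type; `= cc_C6 • Φ6'`). -/
def ΦE : Finset C6 := {ofAdd 1, ofAdd 3, ofAdd 5}

/-- `ΦE` is the conjugate of `Φ6'` (`Examples.lean`), the other `k`-induced type. -/
theorem ΦE_eq : ΦE = cc_C6 • Φ6' := by decide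

/-- Class representatives of the two isogeny classes of corners: `true` = the class of `B` (type `Φ6`),
`false` = the class of `E³` (type `ΦE`). -/
def reps : Bool → Finset C6
  | true => Φ6
  | false => ΦE

/-- The classes of the four corners of a packet: `B, B, B, E`. -/
def packetClass : Fin 4 → Bool := ![true, true, true, false]

/-- The twists of the four corners of the packet with base `m`: `m, m + 2, m + 4, m`. -/
def packetTwist (m : ZMod 6) : Fin 4 → C6 := ![ofAdd m, ofAdd (m + 2), ofAdd (m + 4), ofAdd m]

/-- The corners of the packet with base `m` are `Φ6 + m, Φ6 + m + 2, Φ6 + m + 4, ΦE + m`. -/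
theorem corner_packet (m : ZMod 6) :
    corner reps packetClass (packetTwist m) = ![ofAdd m • Φ6, ofAdd (m + 2) • Φ6, ofAdd (m + 4) • Φ6,
      ofAdd m • ΦE] := by
  revert m; decide

/-- Every sealed face is a packet: its corners, read in `C6`, are the corners of the packet with some
base `m` (`decide` over the `48` faces; this is the sealed clause (3) in the model's words). -/
theorem faces_eq_packet :
    ∀ f ∈ Coordinates.faces, ∃ m : ZMod 6,
      ((Coordinates.corners f.1 f.2.1 f.2.2).map toC6).toFinset =
        univ.image (corner reps packetClass (packetTwist m)) := by
  decide +kernel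

/-- The `(class, twist)` pairs of a packet are pairwise distinct. -/
theorem packet_injective (m : ZMod 6) :
    Function.Injective fun i => (packetClass i, packetTwist m i) := by
  revert m; decide

/-- The packet satisfies `SumTwo` (`decide`; also an instance of `sumTwo_faceCorners`). -/
theorem sumTwo_packet (m : ZMod 6) : SumTwo (corner reps packetClass (packetTwist m)) := by
  unfold SumTwo; revert m; decide

/-- **Lemma R for the sextic packet**: the reduced set at every embedding `s` is a Pohlmann set of the
product type `(Φ6, ΦE)` of `B × E³`. -/
theorem isHodgeSetProd_packet (m : ZMod 6) (s : C6) :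
    IsHodgeSetProd cc_C6 reps (reducedSet packetClass (packetTwist m) s) :=
  isHodgeSetProd_reducedSet cc_C6_isComplexConj reps _ _ (packet_injective m) (sumTwo_packet m) s

/-- The type map `B³ × E³ → B × E` on embeddings: `B`-embeddings to the `F`-block, `E`-embeddings to the
`k`-block (restriction `ℤ/6 → ℤ/2`). -/
def ρ : Bool × C6 → Coordinates.Pt
  | (true, x) => Sum.inl (toAdd x)
  | (false, x) => Sum.inr ((toAdd x).val : ZMod 2)

/-- `ρ` is a type map: equivariant, and it pulls the sealed `phi` back to `(Φ6, ΦE)` (`decide`). -/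
theorem isTypeMap_ρ : IsTypeMap reps Coordinates.phi ρ where
  equivariant := by decide
  mem_iff := by decide

/-- `ρ` is injective on every reduced set of every packet (`decide` on the cardinalities). -/
theorem injOn_ρ_reducedSet (m : ZMod 6) (s : C6) :
    Set.InjOn ρ (reducedSet packetClass (packetTwist m) s) :=
  Finset.card_image_iff.1 (by revert m s; decide)

/-! ### The Weil plane -/

/-- **Structural**: the image in `Pt` of Lemma R's reduced set of a packet is a Pohlmann set of
`(Pt, phi)`, by transfer along the type map `ρ` — this is why the Weil line of the face lives on `B × E`. -/
theorem isHodgeSetOn_image_reducedSet (m : ZMod 6) (s : C6) :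
    IsHodgeSetOn cc_C6 Coordinates.phi ((reducedSet packetClass (packetTwist m) s).image ρ) :=
  (isTypeMap_ρ.isHodgeSetOn_image_iff cc_C6 _ (injOn_ρ_reducedSet m s)).2 (isHodgeSetProd_packet m s)

/-- Hence it is a sealed Pohlmann `4`-set (`hodgeSets`). -/
theorem image_reducedSet_mem_hodgeSets (m : ZMod 6) (s : C6) :
    (reducedSet packetClass (packetTwist m) s).image ρ ∈ Coordinates.hodgeSets := by
  rw [mem_hodgeSets_iff]
  refine ⟨?_, isHodgeSetOn_image_reducedSet m s⟩
  rw [card_image_of_injOn (injOn_ρ_reducedSet m s), card_reducedSet _ _ (packet_injective m),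
    Fintype.card_fin]

/-- The images of the reduced sets are the two sealed Weil-plane generators
`{σ⁰,σ²,σ⁴} ⊔ {e₀}`, `{σ¹,σ³,σ⁵} ⊔ {e₁}` (`decide`, all `m`, `s`). -/
theorem image_reducedSet_mem (m : ZMod 6) (s : C6) :
    (reducedSet packetClass (packetTwist m) s).image ρ ∈
      ({ {Sum.inl 0, Sum.inl 2, Sum.inl 4, Sum.inr 0}, {Sum.inl 1, Sum.inl 3, Sum.inl 5, Sum.inr 1} } :
        Finset (Finset Coordinates.Pt)) := by
  revert m s; decide

/-- **The sealed Weil plane IS Lemma R**: the sealed non-`c`-stable Pohlmann `4`-sets of `B × E`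
(clause (4)) are exactly the images of the reduced sets of the base packet at the six embeddings. -/
theorem weilPlane_eq_image_reducedSets :
    (Coordinates.hodgeSets.filter fun P => ∃ x ∈ P, Coordinates.act 3 x ∉ P) =
      (univ : Finset C6).image fun s => (reducedSet packetClass (packetTwist 0) s).image ρ := by
  decide

end SexticBridge

end HodgeRepro
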